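import Literature.AlgebraicGeometry.Resolution.PointBlowupShadeCentres
import Literature.Barriers.ResolutionOfSingularities.ResidualOrderUnbounded
import Literature.AlgebraicGeometry.Resolution.AffinePointBlowupAlgebra
import Literature.AlgebraicGeometry.Resolution.MarkedIdeals
import HarnessLib
import HarnessLib.Audit.Tags

/-!
# Purely inseparable four-folds `z^p + F(x₁, …, x₄)` — the TARGET FRAME of cell `res-dim4-pi`

[OURS · CANDIDATE FRAME · not Hironaka's statement] (D-0157 DOOR 2; director-resolution DR-157-C;
desk `boards/ROUTES.md` WORDS #1–#3, #10). This file holds DEFINITIONS ONLY — the one set of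
declarations against which the cell's skeleton (`HOME/lines/dim4-pi/line.lean`), every engine
certificate and every candidate secondary invariant is stated. It proves nothing and asserts nothing;
resolution of singularities in dimension ≥ 4 / characteristic `p` is NOT proved anywhere in this
programme; the conjecture-tagged declarations below are typed QUESTIONS, counted 0.

## The texts of record (desk WORDS, verbatim where it matters)

* WORD #1 — CLASS / CONFIGURATION v1. Ground field `k = 𝔽_p^alg`; `q := p^e`. OBJECT:
  `f = z^q + F(x₁..x_n)`, `F ∈ k[x₁..x_n]`, studied at closed points of multiplicity exactly `q`.
  CLASS OF RECORD `(n, e) = (4, 1)`: `z^p + F(x₁..x₄)`, a four-fold in `𝔸⁵`. CLEAN: `F` is clean iff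
  no monomial `c·x^a` of `F` has `q ∣ aᵢ` for all `i`; cleaning = deleting those monomials
  (`z ↦ z − c^{1/q} x^{a/q}`), the tree's `Hauser2010.deletePthPowers` / `HauserPerlega.IsClean`.
  CONFIGURATION = `(p, e, n, Δ, F)` with `Δ` the exceptional variables and `F` clean, `ord₀ F ≥ q`.
* WORD #2 — LETTERS. `d = resordHP := ord₀ G` where `F = x^r · G`, `rᵢ = ord_{(xᵢ)} F` (`i ∈ Δ`):
  the residual order / shade — here `CentreBlowup.CState.shade = ord₀ F − |r|`. Primary lex vector
  of record `ι = (ord, d)`.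
* WORD #3 — STEP. Permissible centres (Hauser–Perlega §2): `P = (z, xᵢ : i ∈ Γ)` with
  (1) `f ∈ P^q` and (2) `G ∈ P^d`. Charts / transform / cleaning / new exceptional data = the tree's
  `CentreBlowup.step q Γ j b` (chart `j ∈ Γ`, translation `b`, `b_j = 0`). Closed points visited: those
  at which the transform is again `q`-fold (`CentreBlowup.IsEquimultiplePoint`). STEP FLAGS: DROP
  (`d' < d`) · EQUAL · RISE:d (`d' > d`) — a RISE of `d` is a fact about the letter `d`, never "a
  counterexample to resolution". MODE 0 = points only (`Γ = {1..n}`); MODE 2 = every permissible `Γ`.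
* WORD #10 — MODE OF RECORD = MODE 1h: among the coordinate centres satisfying (1) ONLY
  (Hironaka-permissible: regular and inside the multiplicity-`q` locus) blow up the LARGEST (least
  `|Γ|`; the engines break ties lex, this file allows every tie); condition (2) is logged as the bit
  `perm2`. «Terminates» (this file, `Terminates1h`) = there is NO infinite sequence of MODE-1h steps
  `s₀ → s₁ → …` of presented states over any field of characteristic `p` — every branch of every
  MODE-1h blow-up tree of the class is finite, i.e. along every branch the multiplicity eventually
  drops below `p`.

## Contents

§1 presented states and centres · §2 the step relations MODE 0 / 1h / 2 / HP and the flags ·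
§3 the termination and secondary-invariant frames (`Terminates1h`, `SecondaryInvariantExists`,
their closed `@[conjecture]` forms) · §4 the scheme-level target `OrderReduction` (marked order-`p`
reduction of `(𝔸⁵, (z^p + F), ∅, p)`, the class-(4,1) instance of the host crux
`MarkedTransfer.HypersurfaceOrderReduction`, item stmt-ResolutionOfSingularities-16155).

bears_on: LADDER-RESOLUTION:D157-DOOR2 (res-dim4-pi). Supports stmt-ResolutionOfSingularities-16155
(helper).
-/

set_option linter.dupNamespace false

noncomputable section

open MvPolynomial Finset AlgebraicGeometry CategoryTheory

namespace Summit.ResolutionOfSingularities.ResolutionOfSingularities.Theorems.PIDim4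

open Literature.AlgebraicGeometry.Resolution
open Literature.AlgebraicGeometry.Resolution.Hauser2010
open Literature.Barriers.ResolutionOfSingularities

/-! ## 1. Presented states and coordinate centres -/

/-- A **presented state** of the class: the tree's coordinate-centre walk state `(F, r, exc)` in the
four base variables — `F` the (cleaned) `F` of `z^p + F`, `r` the exceptional multiplicities
(`F = x^r · G`), `exc` the exceptional components through the point (WORD #1 `Δ`).
[cite: Hauser2010, §F (setting f = x^p + y^r g)] [cite: HauserPerlega2019PRIMS, §2] -/
abbrev State (K : Type) [Field K] : Type := CentreBlowup.CState (Fin 4) K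

/-- **Hironaka-permissible coordinate centre** `V(z, x_S)` for `z^q + F` (condition (1) of
Hauser–Perlega §2 only): `S ≠ ∅` and `F ∈ (x_S)^q`, i.e. `q ≤ ord_{(x_S)} F` — the centre is regular
and lies in the multiplicity-`q` locus. [cite: HauserPerlega2019PRIMS, §2 (condition (1) f ∈ P^{c!})] -/
def IsPermissibleCentre {K : Type} [Field K] (q : ℕ) (S : Finset (Fin 4))
    (F : MvPolynomial (Fin 4) K) : Prop :=
  S.Nonempty ∧ (q : ℕ∞) ≤ CentreBlowup.ordAlong S F

/-- **Condition (2)** of Hauser–Perlega §2 (the engines' bit `perm2`, WORD #10): the residual factor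
`G` lies in `(x_S)^d`, `d = ord₀ G` the shade; with `F = x^r · G` this reads
`ord_{(x_S)} F ≥ Σ_{i ∈ S} rᵢ + d`. [cite: HauserPerlega2019PRIMS, §2 (condition (2) I_{n−1} ⊂ P^d)] -/
def Perm2 {K : Type} [Field K] (S : Finset (Fin 4)) (s : State K) : Prop :=
  (CentreBlowup.degIn S s.r : ℕ∞) + s.shade ≤ CentreBlowup.ordAlong S s.F

/-- **MODE-1h centre of record** (WORD #10): Hironaka-permissible and of least `|S|` (largest
dimension) among the Hironaka-permissible coordinate centres; every tie is allowed (the engines take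
the lex-smallest). [cite: HauserPerlega2019PRIMS, §2] -/
def IsMode1hCentre {K : Type} [Field K] (q : ℕ) (S : Finset (Fin 4))
    (F : MvPolynomial (Fin 4) K) : Prop :=
  IsPermissibleCentre q S F ∧ ∀ S' : Finset (Fin 4), IsPermissibleCentre q S' F → S.card ≤ S'.card

/-! ## 2. Step relations (MODE 0 / 1h / 2 / HP) and flags -/

/-- **One blow-up edge along `V(z, x_S)`**: chart `j ∈ S`, closed point `b` of the new exceptional
hyperplane (`b_j = 0`; `bᵢ`, `i ∉ S`, moves along the centre) at which the transform is again
`q`-fold, followed by cleaning — the tree's `CentreBlowup.step`; the new `F` is required non-zero so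
that the degenerate datum `F = 0` has no successor (WORD #3 charts / transform / Δ').
[cite: HauserPerlega2019PRIMS, §2 (the blowup in the x₁-chart)] [cite: Hauser2010, §§F–G] -/
def Edge {K : Type} [Field K] [DecidableEq K] (q : ℕ) (S : Finset (Fin 4)) (s s' : State K) : Prop :=
  ∃ (j : Fin 4) (b : Fin 4 → K), j ∈ S ∧ b j = 0 ∧ CentreBlowup.IsEquimultiplePoint q S j b s ∧
    (CentreBlowup.step q S j b s).F ≠ 0 ∧ s' = CentreBlowup.step q S j b s

/-- **MODE 0 step** (points only, `S = {1..4}`; calibration mode, WORD #3 / #10). [folklore] -/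
def Step0 {K : Type} [Field K] [DecidableEq K] (q : ℕ) (s s' : State K) : Prop :=
  (q : ℕ∞) ≤ CentreBlowup.ordAlong Finset.univ s.F ∧ Edge q Finset.univ s s'

/-- **MODE 1h step** (the mode of record, WORD #10). [folklore] -/
def Step1h {K : Type} [Field K] [DecidableEq K] (q : ℕ) (s s' : State K) : Prop :=
  ∃ S : Finset (Fin 4), IsMode1hCentre q S s.F ∧ Edge q S s s'

/-- **MODE 2 step** (any Hironaka-permissible coordinate centre, WORD #3 / #10). [folklore] -/
def Step2 {K : Type} [Field K] [DecidableEq K] (q : ℕ) (s s' : State K) : Prop :=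
  ∃ S : Finset (Fin 4), IsPermissibleCentre q S s.F ∧ Edge q S s s'

/-- **HP-permissible step** (conditions (1) ∧ (2), WORD #3 MODE 1 v1 / the sub-run `m1` of WORD #13).
[cite: HauserPerlega2019PRIMS, §2 (permissible blowups)] -/
def StepHP {K : Type} [Field K] [DecidableEq K] (q : ℕ) (s s' : State K) : Prop :=
  ∃ S : Finset (Fin 4), IsPermissibleCentre q S s.F ∧ Perm2 S s ∧ Edge q S s s'

/-- Flag **RISE:d** (the jump of record v1, letter `d` = shade). [cite: Hauser2010, §F (increase of the shade)]
[cite: Moh1987, Stability Theorem (d' ≤ d + p^{e−1})] -/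
def RiseD {K : Type} [Field K] (s s' : State K) : Prop := s.shade < s'.shade

/-- Flag **DROP** (`d' < d`). [folklore] -/
def DropD {K : Type} [Field K] (s s' : State K) : Prop := s'.shade < s.shade

/-- Flag **EQUAL** (`d' = d`; three in a row under MODE 1h = a PLATEAU of record). [folklore] -/
def EqualD {K : Type} [Field K] (s s' : State K) : Prop := s'.shade = s.shade

/-! ## 3. Termination and secondary-invariant frames -/

/-- **Terminates (MODE 1h)** at the exponent `q`: over every field of characteristic `p` there is no
infinite sequence of MODE-1h steps. [OURS · CANDIDATE FRAME] [folklore] -/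
def Terminates1h (p q : ℕ) : Prop :=
  ∀ (K : Type) [Field K] [CharP K p] [DecidableEq K],
    ¬ ∃ c : ℕ → State K, ∀ k, Step1h q (c k) (c (k + 1))

/-- **A secondary invariant exists (MODE 1h)**, PRESENTATION-RELATIVE (WORD #9): a well-founded
order `W` and `Φ : State → W` dropping strictly across every MODE-1h step. Classically equivalent to
`Terminates1h` (well-foundedness of the inverse step relation); the cell hunts an EXPLICIT `Φ`, a
lex word over the letters of WORD #2. [OURS · CANDIDATE FRAME] [folklore] -/
def SecondaryInvariantExists (p q : ℕ) : Prop :=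
  ∀ (K : Type) [Field K] [CharP K p] [DecidableEq K],
    ∃ (W : Type) (lt : W → W → Prop), WellFounded lt ∧
      ∃ Φ : State K → W, ∀ s s' : State K, Step1h q s s' → lt (Φ s') (Φ s)

/-- Renaming the four base variables of a presented state (the typed shadow of intrinsic-ness,
WORD #9: a candidate `Φ` should at least be invariant under it). [folklore] -/
def State.rename {K : Type} [Field K] (e : Equiv.Perm (Fin 4)) (s : State K) : State K :=
  ⟨MvPolynomial.rename e s.F, s.r.mapDomain e, s.exc.map e.toEmbedding⟩

/-- `SecondaryInvariantExists` with a renaming-invariant `Φ`. [OURS · CANDIDATE FRAME] [folklore] -/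
def SecondaryInvariantExistsSym (p q : ℕ) : Prop :=
  ∀ (K : Type) [Field K] [CharP K p] [DecidableEq K],
    ∃ (W : Type) (lt : W → W → Prop), WellFounded lt ∧
      ∃ Φ : State K → W, (∀ s s' : State K, Step1h q s s' → lt (Φ s') (Φ s)) ∧
        ∀ (e : Equiv.Perm (Fin 4)) (s : State K), Φ (State.rename e s) = Φ s

/-- **The cell's question, class (4,1)**: the MODE-1h game on `z^p + F(x₁..x₄)` terminates for every
prime `p`. A typed QUESTION posed by this programme (no printed source states it; the printed
evidence either way is the desk census `boards/DIM4-CENSUS.md` §A). [OURS · CANDIDATE FRAME · not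
Hironaka's statement] [cite: HauserPerlega2019PRIMS, §3 (larger centres exit the cycles; posed here for n = 4, e = 1)] -/
@[conjecture] def Terminates1hQuestion : Prop := ∀ p : ℕ, p.Prime → Terminates1h p p

/-! ## 4. The scheme-level target: marked order-`p` reduction of `z^p + F(x₁..x₄)` -/

/-- The hypersurface polynomial `z^p + F(x₁, …, x₄) ∈ K[z, x₁, …, x₄]` (`z = X 0`, `xᵢ = X i.succ`).
[folklore] -/
def hyp {K : Type} [Field K] (p : ℕ) (F : MvPolynomial (Fin 4) K) : MvPolynomial (Fin (4 + 1)) K :=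
  X 0 ^ p + MvPolynomial.rename Fin.succ F

/-- Its ideal sheaf on `𝔸⁵_K = Spec K[z, x₁, …, x₄]` (the tree's `AffinePointBlowup.P 4 K`). [folklore] -/
def hypSheaf {K : Type} [Field K] (p : ℕ) (F : MvPolynomial (Fin 4) K) :
    (AffinePointBlowup.P 4 K).IdealSheafData :=
  Scheme.IdealSheafData.ofIdealTop (Ideal.span {(AffinePointBlowup.γ 4 K).symm (hyp p F)})

/-- **Order-`p` reduction of the class (marked form)** at the prime `p`: for every algebraically
closed `K` of characteristic `p` and every non-zero clean `F ∈ K[x₁..x₄]`, the marked ideal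
`(𝔸⁵_K, (z^p + F), ∅, p)` admits a marked resolution (`IsMarkedResolution`: blow-ups in regular
centres inside the order-`p` locus, snc with the boundary, controlled transforms, ending with no point
of order `p`). The class-(4,1) instance of `MarkedTransfer.HypersurfaceOrderReduction` with
`X = 𝔸⁵`, `I = (z^p + F)`, `E = ∅`, `m = p`; for `p = 2` this is embedded resolution of the class,
for `p > 2` points of multiplicity `< p` remain (honest scope). [OURS · CANDIDATE FRAME]
[cite: Hironaka1964, Main Theorem I (the characteristic-zero statement whose characteristic-p analogue is asked)] -/
def OrderReduction (p : ℕ) : Prop :=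
  ∀ (K : Type) [Field K] [IsAlgClosed K] [CharP K p] (F : MvPolynomial (Fin 4) K),
    F ≠ 0 → HauserPerlega.IsClean p F →
      ∃ (X' : Scheme.{0}) (π : X' ⟶ AffinePointBlowup.P 4 K) (M' : MarkedIdeal X'),
        IsMarkedResolution (⟨hypSheaf p F, [], p⟩ : MarkedIdeal (AffinePointBlowup.P 4 K)) π M'

/-- **The dimension-four purely-inseparable order-reduction question** (all primes).
[OURS · CANDIDATE FRAME · not Hironaka's statement]
[cite: Hironaka1964, Main Theorem I (characteristic zero; the positive-characteristic case in dimension ≥ 4 is open)] -/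
@[conjecture] def OrderReductionQuestion : Prop := ∀ p : ℕ, p.Prime → OrderReduction p

/-- **S3 frame**: termination of the MODE-1h game at `q = p` implies the scheme-level order-`p`
reduction (chart dictionary blow-up ↔ `CentreBlowup.step`, equimultiple points = order-`p` points,
globalisation of the local branches). [OURS · CANDIDATE FRAME] [folklore] -/
def TerminationImpliesOrderReduction (p : ℕ) : Prop := Terminates1h p p → OrderReduction p

end Summit.ResolutionOfSingularities.ResolutionOfSingularities.Theorems.PIDim4

end
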